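import Mathlib
import Literature.NumberTheory.LFunctions.WeilArchimedeanPositivityProofs
import Literature.NumberTheory.LFunctions.WeilArchimedeanMoments
import Literature.NumberTheory.LFunctions.WeilExplicitProofs
import Literature.NumberTheory.LFunctions.WeilLogLatticeComb
import HarnessLib

/-!
# T42a — Mollifier profiles for the verified-height split

Solo programme `solo-RiemannHypothesis-informed`, claim T42 (the converse direction of the
window ↔ height dictionary: what a verification of RH up to height `T₀` buys for the sign of the
Weil ground energy `ε(a)`), part (a): the MOLLIFIER.

A mollifier profile is a real, smooth, non-negative function `ψ` of mass one supported in
`[-δ, δ]` (`IsMollifier ψ δ`).  Its complexification `ψc = mollC ψ` is a Weil test function and the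
kernel `φ = ψc ⋆ ψ̃c` (`mollKernel ψ`) has the three properties the split `K = K ⋆ φ + (K - K ⋆ φ)`
of T42 needs:

* on the critical line `φ̂(1/2 + it) = |ψ̂(1/2 + it)|² ∈ [0, 1]` and
  `1 - |ψ̂(1/2 + it)|² ≤ δ² t²` (`one_sub_norm_sq_weilMellin_le`): the high-pass factor `1 - φ̂`
  is small at low height;
* at the poles `‖1 - φ̂(0)‖, ‖1 - φ̂(1)‖ ≤ e^δ - 1` (`norm_one_sub_weilMellin_mollKernel_zero_le`,
  `…_one_le`): the polar term of the high part is tiny;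
* in the closed strip `‖φ̂(ρ)‖ ≤ (∫‖ψc^{(k)}‖e^{|t|/2})² / |Im ρ|^{2k}`
  (`norm_weilMellin_mollKernel_le`): the low part dies above the verified height.

All statements are hypothesis-free consequences of the definitions; the number theory enters in
T42b–d.
-/

open scoped ContDiff ComplexConjugate
open Complex MeasureTheory Set Filter Literature.NumberTheory.LFunctions

namespace Summit.RiemannHypothesis.RiemannHypothesis.Theorems

/-- A mollifier profile of radius `δ`: real, smooth, non-negative, mass one, supported in
`[-δ, δ]`. -/
structure IsMollifier (ψ : ℝ → ℝ) (δ : ℝ) : Prop where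
  contDiff : ContDiff ℝ ∞ ψ
  nonneg : ∀ x, 0 ≤ ψ x
  mass : ∫ x, ψ x = 1
  supp : tsupport ψ ⊆ Icc (-δ) δ

/-- The complexification `ψc(x) = ψ(x)` of a real profile. -/
def mollC (ψ : ℝ → ℝ) : ℝ → ℂ := fun x ↦ (ψ x : ℂ)

/-- The mollifier kernel `φ = ψc ⋆ ψ̃c`. -/
noncomputable def mollKernel (ψ : ℝ → ℝ) : ℝ → ℂ := weilConv (mollC ψ) (weilReflect (mollC ψ))

namespace IsMollifier

variable {ψ : ℝ → ℝ} {δ : ℝ}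

/-- The support of the complexification is the support of the profile. -/
theorem tsupport_mollC (ψ : ℝ → ℝ) : tsupport (mollC ψ) = tsupport ψ := by
  have : Function.support (mollC ψ) = Function.support ψ := by
    ext x; simp [mollC]
  simp only [tsupport, this]

/-- A profile has compact support. -/
theorem hasCompactSupport (h : IsMollifier ψ δ) : HasCompactSupport ψ :=
  isCompact_Icc.of_isClosed_subset (isClosed_tsupport ψ) h.supp

/-- A profile is continuous. -/
theorem continuous (h : IsMollifier ψ δ) : Continuous ψ := h.contDiff.continuous

/-- A profile is integrable. -/
theorem integrable (h : IsMollifier ψ δ) : Integrable ψ :=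
  h.continuous.integrable_of_hasCompactSupport h.hasCompactSupport

/-- The radius of a profile is non-negative (the support contains a point, since the mass is one). -/
theorem radius_nonneg (h : IsMollifier ψ δ) : 0 ≤ δ := by
  by_contra hδ
  push Not at hδ
  have hI : Icc (-δ) δ = ∅ := Icc_eq_empty (by linarith)
  have hs : tsupport ψ = ∅ := subset_empty_iff.mp (hI ▸ h.supp)
  have hψ : ψ = 0 := by
    funext x
    exact image_eq_zero_of_notMem_tsupport (by simp [hs])
  have := h.mass
  simp [hψ] at this

/-- The complexification is a Weil test function. -/
theorem isWeilTest (h : IsMollifier ψ δ) : IsWeilTest (mollC ψ) := by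
  refine ⟨ofRealCLM.contDiff.comp h.contDiff, ?_⟩
  show IsCompact (tsupport (mollC ψ))
  rw [tsupport_mollC]
  exact h.hasCompactSupport

/-- The complexification is supported in `[-δ, δ]`. -/
theorem tsupport_subset (h : IsMollifier ψ δ) : tsupport (mollC ψ) ⊆ Icc (-δ) δ := by
  rw [tsupport_mollC]; exact h.supp

/-- Off `[-δ, δ]` the profile vanishes. -/
theorem eq_zero_of_lt (h : IsMollifier ψ δ) {x : ℝ} (hx : δ < |x|) : ψ x = 0 := by
  apply image_eq_zero_of_notMem_tsupport
  intro hx'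
  have := h.supp hx'
  rw [mem_Icc, ← abs_le] at this
  linarith

/-- `ψ(x) x² ≤ δ² ψ(x)` pointwise. -/
theorem mul_sq_le (h : IsMollifier ψ δ) (x : ℝ) : ψ x * x ^ 2 ≤ δ ^ 2 * ψ x := by
  by_cases hx : δ < |x|
  · simp [h.eq_zero_of_lt hx]
  · push Not at hx
    have : x ^ 2 ≤ δ ^ 2 := by
      rw [← sq_abs]; exact pow_le_pow_left₀ (abs_nonneg x) hx 2
    nlinarith [h.nonneg x]

/-- `‖ψc‖₁ = 1`. -/
theorem weilNorm1_eq (h : IsMollifier ψ δ) : weilNorm1 (mollC ψ) = 1 := by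
  unfold weilNorm1 mollC
  have : ∀ x, ‖(ψ x : ℂ)‖ = ψ x := fun x ↦ by
    rw [Complex.norm_real, Real.norm_of_nonneg (h.nonneg x)]
  simp_rw [this]
  exact h.mass

/-- `ψ̂c(1/2) = 1` (the mass). -/
theorem weilMellin_half (h : IsMollifier ψ δ) : weilMellin (mollC ψ) (1 / 2) = 1 := by
  unfold weilMellin mollC
  simp only [sub_self, zero_mul, Complex.exp_zero, mul_one]
  rw [integral_complex_ofReal, h.mass]
  simp

/-- On the critical line `‖ψ̂c(1/2 + it)‖ ≤ 1`. -/
theorem norm_weilMellin_half_line_le_one (h : IsMollifier ψ δ) (t : ℝ) :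
    ‖weilMellin (mollC ψ) (1 / 2 + t * I)‖ ≤ 1 := by
  have := norm_weilMellin_half_line_le h.isWeilTest t
  rwa [h.weilNorm1_eq] at this

/-- `Re ψ̂c(1/2 + it) = ∫ ψ(x) cos(tx) dx`. -/
theorem re_weilMellin_half_line (h : IsMollifier ψ δ) (t : ℝ) :
    (weilMellin (mollC ψ) (1 / 2 + t * I)).re = ∫ x, ψ x * Real.cos (t * x) := by
  unfold weilMellin
  have hint : Integrable fun x : ℝ ↦ mollC ψ x * cexp ((1 / 2 + t * I - 1 / 2) * x) :=
    integrable_weilIntegrand h.isWeilTest.1.continuous h.isWeilTest.2 _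
  have hre := integral_re hint
  simp only [RCLike.re_to_complex] at hre
  rw [← hre]
  congr 1 with x
  have hz : (1 / 2 + t * I - 1 / 2) * (x : ℂ) = ((t * x : ℝ) : ℂ) * I := by push_cast; ring
  rw [hz, mollC, Complex.re_ofReal_mul, Complex.exp_ofReal_mul_I_re]

/-- `Re ψ̂c(1/2 + it) ≥ 1 - δ²t²/2` (from `cos y ≥ 1 - y²/2` and `|x| ≤ δ` on the support). -/
theorem re_weilMellin_half_line_ge (h : IsMollifier ψ δ) (t : ℝ) :
    1 - δ ^ 2 * t ^ 2 / 2 ≤ (weilMellin (mollC ψ) (1 / 2 + t * I)).re := by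
  rw [h.re_weilMellin_half_line t]
  have hψi := h.integrable
  have h1 : ∫ x, (1 - δ ^ 2 * t ^ 2 / 2) * ψ x ≤ ∫ x, ψ x * Real.cos (t * x) := by
    refine integral_mono (hψi.const_mul _) ?_ fun x ↦ ?_
    · exact (h.continuous.mul (by fun_prop)).integrable_of_hasCompactSupport
        h.hasCompactSupport.mul_right
    · have hc := Real.one_sub_sq_div_two_le_cos (x := t * x)
      have hx := h.mul_sq_le x
      have h0 := h.nonneg x
      have : ψ x * (1 - (t * x) ^ 2 / 2) ≤ ψ x * Real.cos (t * x) :=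
        mul_le_mul_of_nonneg_left hc h0
      nlinarith
  rw [integral_const_mul, h.mass, mul_one] at h1
  exact h1

/-- **Low-height transparency.** `1 - ‖ψ̂c(1/2 + it)‖² ≤ δ² t²`. -/
theorem one_sub_norm_sq_weilMellin_le (h : IsMollifier ψ δ) (t : ℝ) :
    1 - ‖weilMellin (mollC ψ) (1 / 2 + t * I)‖ ^ 2 ≤ δ ^ 2 * t ^ 2 := by
  have hre := h.re_weilMellin_half_line_ge t
  have hle : (weilMellin (mollC ψ) (1 / 2 + t * I)).re ≤ ‖weilMellin (mollC ψ) (1 / 2 + t * I)‖ :=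
    Complex.re_le_norm _
  set r := ‖weilMellin (mollC ψ) (1 / 2 + t * I)‖
  by_cases hr : δ ^ 2 * t ^ 2 ≤ 2
  · have h1 : 1 - δ ^ 2 * t ^ 2 / 2 ≤ r := hre.trans hle
    have h2 : 0 ≤ 1 - δ ^ 2 * t ^ 2 / 2 := by linarith
    have hprod := mul_le_mul h1 h1 h2 (h2.trans h1)
    nlinarith [hprod, sq_nonneg (δ ^ 2 * t ^ 2), sq_nonneg (δ * t)]
  · push Not at hr
    nlinarith [norm_nonneg (weilMellin (mollC ψ) (1 / 2 + t * I))]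

/-- At a real point `σ` with `|σ - 1/2| ≤ 1/2`: `‖ψ̂c(σ) - 1‖ ≤ e^{δ/2} - 1`. -/
theorem norm_weilMellin_real_sub_one_le (h : IsMollifier ψ δ) {σ : ℝ} (hσ : |σ - 1 / 2| ≤ 1 / 2) :
    ‖weilMellin (mollC ψ) σ - 1‖ ≤ Real.exp (δ / 2) - 1 := by
  -- `|e^y - 1| ≤ e^{|y|} - 1` (also `Literature.Geometry.Lorentzian.Deformation.abs_exp_sub_one_le_exp_abs_sub_one`,
  -- re-proved inline to keep the Weil toolkit free of the Lorentzian-geometry import)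
  have habs : ∀ y : ℝ, |Real.exp y - 1| ≤ Real.exp |y| - 1 := by
    intro y
    rcases le_or_gt 0 y with hy | hy
    · rw [abs_of_nonneg hy, abs_of_nonneg (by linarith [Real.one_le_exp hy])]
    · rw [abs_of_neg hy, abs_of_nonpos (by linarith [Real.exp_le_one_iff.2 hy.le])]
      have h1 := Real.add_one_le_exp y
      have h2 := Real.add_one_le_exp (-y)
      have h3 : Real.exp y * Real.exp (-y) = 1 := by rw [← Real.exp_add]; simp
      nlinarith [Real.exp_pos y, Real.exp_pos (-y)]
  have hW := h.isWeilTest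
  have hi1 : Integrable fun x : ℝ ↦ mollC ψ x * cexp (((σ : ℂ) - 1 / 2) * x) :=
    integrable_weilIntegrand hW.1.continuous hW.2 _
  have hi2 : Integrable fun x : ℝ ↦ mollC ψ x * cexp (((1 / 2 : ℂ) - 1 / 2) * x) :=
    integrable_weilIntegrand hW.1.continuous hW.2 _
  rw [← h.weilMellin_half]
  unfold weilMellin
  rw [← integral_sub hi1 hi2]
  have hpt : ∀ x : ℝ, ‖mollC ψ x * cexp (((σ : ℂ) - 1 / 2) * x) -
      mollC ψ x * cexp (((1 / 2 : ℂ) - 1 / 2) * x)‖ ≤ (Real.exp (δ / 2) - 1) * ψ x := by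
    intro x
    rw [← mul_sub, norm_mul, mollC, Complex.norm_real, Real.norm_of_nonneg (h.nonneg x), mul_comm]
    by_cases hx : δ < |x|
    · simp [h.eq_zero_of_lt hx]
    · push Not at hx
      refine mul_le_mul_of_nonneg_right ?_ (h.nonneg x)
      have e1 : ((σ : ℂ) - 1 / 2) * x = (((σ - 1 / 2) * x : ℝ) : ℂ) := by push_cast; ring
      have e2 : ((1 / 2 : ℂ) - 1 / 2) * x = 0 := by ring
      rw [e1, e2, Complex.exp_zero, ← Complex.ofReal_exp, ← Complex.ofReal_one,
        ← Complex.ofReal_sub, Complex.norm_real, Real.norm_eq_abs]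
      refine (habs _).trans ?_
      gcongr
      rw [abs_mul]
      calc |σ - 1 / 2| * |x| ≤ 1 / 2 * δ := mul_le_mul hσ hx (abs_nonneg x) (by norm_num)
        _ = δ / 2 := by ring
  refine (norm_integral_le_integral_norm _).trans ?_
  calc ∫ x, ‖mollC ψ x * cexp (((σ : ℂ) - 1 / 2) * x) -
        mollC ψ x * cexp (((1 / 2 : ℂ) - 1 / 2) * x)‖
      ≤ ∫ x, (Real.exp (δ / 2) - 1) * ψ x :=
        integral_mono_of_nonneg (Eventually.of_forall fun _ ↦ norm_nonneg _)
          (h.integrable.const_mul _) (Eventually.of_forall hpt)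
    _ = Real.exp (δ / 2) - 1 := by rw [integral_const_mul, h.mass, mul_one]

/-- `‖ψ̂c(0) - 1‖ ≤ e^{δ/2} - 1`. -/
theorem norm_weilMellin_zero_sub_one_le (h : IsMollifier ψ δ) :
    ‖weilMellin (mollC ψ) 0 - 1‖ ≤ Real.exp (δ / 2) - 1 := by
  have := h.norm_weilMellin_real_sub_one_le (σ := 0) (by norm_num)
  simpa using this

/-- `‖ψ̂c(1) - 1‖ ≤ e^{δ/2} - 1`. -/
theorem norm_weilMellin_one_sub_one_le (h : IsMollifier ψ δ) :
    ‖weilMellin (mollC ψ) 1 - 1‖ ≤ Real.exp (δ / 2) - 1 := by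
  have := h.norm_weilMellin_real_sub_one_le (σ := 1) (by norm_num)
  simpa using this

/-! ## The kernel `φ = ψc ⋆ ψ̃c` -/

/-- The kernel is a test function. -/
theorem isWeilTest_mollKernel (h : IsMollifier ψ δ) : IsWeilTest (mollKernel ψ) :=
  h.isWeilTest.weilConv h.isWeilTest.weilReflect

/-- The kernel is supported in `[-2δ, 2δ]`. -/
theorem tsupport_mollKernel_subset (h : IsMollifier ψ δ) :
    tsupport (mollKernel ψ) ⊆ Icc (-(2 * δ)) (2 * δ) :=
  tsupport_weilConv_weilReflect_subset h.isWeilTest.2 h.tsupport_subset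

/-- On the critical line `φ̂(1/2 + it) = |ψ̂c(1/2 + it)|²`. -/
theorem weilMellin_mollKernel_half_line (h : IsMollifier ψ δ) (t : ℝ) :
    weilMellin (mollKernel ψ) (1 / 2 + t * I) =
      ((‖weilMellin (mollC ψ) (1 / 2 + t * I)‖ ^ 2 : ℝ) : ℂ) :=
  weilMellin_weilConv_weilReflect_half h.isWeilTest t

/-- On the critical line `0 ≤ φ̂ ≤ 1` and `1 - φ̂(1/2 + it) ≤ δ²t²` (real form). -/
theorem mollKernel_half_line_bounds (h : IsMollifier ψ δ) (t : ℝ) :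
    0 ≤ ‖weilMellin (mollC ψ) (1 / 2 + t * I)‖ ^ 2 ∧
      ‖weilMellin (mollC ψ) (1 / 2 + t * I)‖ ^ 2 ≤ 1 ∧
      1 - ‖weilMellin (mollC ψ) (1 / 2 + t * I)‖ ^ 2 ≤ δ ^ 2 * t ^ 2 := by
  refine ⟨by positivity, ?_, h.one_sub_norm_sq_weilMellin_le t⟩
  have h1 := h.norm_weilMellin_half_line_le_one t
  have h0 := norm_nonneg (weilMellin (mollC ψ) (1 / 2 + t * I))
  nlinarith

/-- `‖1 - z conj w‖ ≤ e^δ - 1` when `‖z - 1‖, ‖w - 1‖ ≤ e^{δ/2} - 1`. -/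
theorem norm_one_sub_mul_conj_le {z w : ℂ} {ε : ℝ} (hz : ‖z - 1‖ ≤ ε) (hw : ‖w - 1‖ ≤ ε) :
    ‖1 - z * conj w‖ ≤ (1 + ε) ^ 2 - 1 := by
  have hε : 0 ≤ ε := (norm_nonneg _).trans hz
  have e : 1 - z * conj w = -((z - 1) + z * (conj w - 1)) := by ring
  rw [e, norm_neg]
  refine (norm_add_le _ _).trans ?_
  rw [norm_mul]
  have hzw : ‖conj w - 1‖ ≤ ε := by
    rw [← Complex.norm_conj, map_sub, Complex.conj_conj, map_one]; exact hw
  have hz1 : ‖z‖ ≤ 1 + ε := by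
    calc ‖z‖ = ‖(z - 1) + 1‖ := by ring_nf
      _ ≤ ‖z - 1‖ + ‖(1 : ℂ)‖ := norm_add_le _ _
      _ ≤ ε + 1 := by simp [hz]
      _ = 1 + ε := by ring
  nlinarith [mul_le_mul hz1 hzw (norm_nonneg _) (by linarith), norm_nonneg z]

/-- **Polar transparency.** `‖1 - φ̂(0)‖ ≤ e^δ - 1`. -/
theorem norm_one_sub_weilMellin_mollKernel_zero_le (h : IsMollifier ψ δ) :
    ‖1 - weilMellin (mollKernel ψ) 0‖ ≤ Real.exp δ - 1 := by
  unfold mollKernel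
  rw [weilMellin_weilQuadratic h.isWeilTest]
  simp only [map_zero, sub_zero]
  have := norm_one_sub_mul_conj_le h.norm_weilMellin_zero_sub_one_le h.norm_weilMellin_one_sub_one_le
  have e : (1 + (Real.exp (δ / 2) - 1)) ^ 2 - 1 = Real.exp δ - 1 := by
    rw [add_sub_cancel, sq, ← Real.exp_add, add_halves]
  rwa [e] at this

/-- **Polar transparency.** `‖1 - φ̂(1)‖ ≤ e^δ - 1`. -/
theorem norm_one_sub_weilMellin_mollKernel_one_le (h : IsMollifier ψ δ) :
    ‖1 - weilMellin (mollKernel ψ) 1‖ ≤ Real.exp δ - 1 := by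
  unfold mollKernel
  rw [weilMellin_weilQuadratic h.isWeilTest]
  simp only [map_one, sub_self]
  have := norm_one_sub_mul_conj_le h.norm_weilMellin_one_sub_one_le h.norm_weilMellin_zero_sub_one_le
  have e : (1 + (Real.exp (δ / 2) - 1)) ^ 2 - 1 = Real.exp δ - 1 := by
    rw [add_sub_cancel, sq, ← Real.exp_add, add_halves]
  rwa [e] at this

/-- **Strip decay.** For `0 ≤ Re ρ ≤ 1`, `Im ρ ≠ 0` and every `k`:
`‖φ̂(ρ)‖ ≤ (weilL1 (ψc^{(k)}))² / |Im ρ|^{2k}`. -/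
theorem norm_weilMellin_mollKernel_le (h : IsMollifier ψ δ) (k : ℕ) {ρ : ℂ} (h0 : 0 ≤ ρ.re)
    (h1 : ρ.re ≤ 1) (him : ρ.im ≠ 0) :
    ‖weilMellin (mollKernel ψ) ρ‖ ≤ weilL1 (deriv^[k] (mollC ψ)) ^ 2 / |ρ.im| ^ (2 * k) := by
  unfold mollKernel
  rw [weilMellin_weilQuadratic h.isWeilTest, norm_mul, Complex.norm_conj]
  have ha := norm_weilMellin_le_weilL1_iterate_deriv_div h.isWeilTest k h0 h1 him
  have h0' : 0 ≤ (1 - conj ρ).re := by simp; linarith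
  have h1' : (1 - conj ρ).re ≤ 1 := by simp; linarith
  have him' : (1 - conj ρ).im ≠ 0 := by simpa using him
  have hb := norm_weilMellin_le_weilL1_iterate_deriv_div h.isWeilTest k h0' h1' him'
  have e : |(1 - conj ρ).im| = |ρ.im| := by simp
  rw [e] at hb
  have hD := weilL1_nonneg (deriv^[k] (mollC ψ))
  have hp : 0 < |ρ.im| ^ k := pow_pos (abs_pos.2 him) k
  calc ‖weilMellin (mollC ψ) ρ‖ * ‖weilMellin (mollC ψ) (1 - conj ρ)‖
      ≤ (weilL1 (deriv^[k] (mollC ψ)) / |ρ.im| ^ k) * (weilL1 (deriv^[k] (mollC ψ)) / |ρ.im| ^ k) :=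
        mul_le_mul ha hb (norm_nonneg _) (div_nonneg hD hp.le)
    _ = weilL1 (deriv^[k] (mollC ψ)) ^ 2 / |ρ.im| ^ (2 * k) := by
        rw [pow_mul', div_mul_div_comm, sq, sq]

end IsMollifier

end Summit.RiemannHypothesis.RiemannHypothesis.Theorems
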